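import Summits.QuantumFields.YangMills.Theorems.BalabanUVNodesN18HLayerW1TermAnalytic

/-!
# BalabanUVNodes ∕ N18 — THE H-LAYER CHAIN FOR node00-def-W1's GENERATOR OF RECORD `𝔇.Gn` FROM THE LOCATED PRIMITIVE INPUTS ALONG THE CONFIGURATION:
# (GEN), W1's `RecAdmissible`, the (2.38) pair at every step, (1.18) for the generated tower, `RecAdmissible` on print's table pair — files 23 ∕ 24's faces
# with BOTH per-term schema binders discharged by file 26 (Track A, DAG node N18 = NE5 `T4OutputRate.NE5 EA EB W κ θ C₅` :211; cluster K4 «SpineRates»;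
# file 29 of seat pub-ymgap-dag-n18-c, row s1 «the H-layer activity datum on the record's torus catalogue», generation 6)

Cell `pub-ymgap`, HUMAN RULING D-0062 (Track A), R134 ACCELERATION seat `pub-ymgap-dag-n18-c` (strategy s1), generation 6.  THEOREMS ONLY (no `def`, no
`instance`, no `sorry`); imports file 26 `…N18HLayerW1TermAnalytic` (through it files 23–25, W1's STOREY 7, T21 `TwoRunTorusPrimitiveParam`, Chae); restates nothing.

WHY.  File 26 proved BOTH per-term schemas of file 23 for a (2.14) term-datum family `𝔇 : W1.TermData214 c (F.P K) 𝔸 M L` along the history from ONE list of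
located PRIMITIVE inputs uniform on the open located-inputs tables `big (k+1) Z` — (T-an) `termwiseAn_TF_of_primitives_param` (print's «analytic function of
(𝐔,𝐉)», [II] p. 15, as a theorem) and (T-226) (the `.2` half of `holAnd226_TF_of_primitives_param`).  The PRIMITIVE currency is the general interface of N18's
chain: kernels `A(σ, uOf φ)`, `G(σ, uOf φ)` holomorphic in `σ` and in `φ` with (L17a)∕(L16a) letters stated directly (no walk-record structure presupposed — the
currency a kernel tower of record such as node00-def-B13's `CarriersB13KernelTower` meets with its own localisation lemmas; file 27 ∕ 28 serve the walk-record
currency `TermWalkData` of NODE A's (D4) road).  The consumers of the chain (dag-n18-d's Stage-12 ∕ 13 junctions `…_of_stepGen`, dag-n27-c's composite,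
dag-n22-*'s strip) read files 23 ∕ 24's faces BY NAME: (GEN) (`StepGen`-shape), W1's `RecAdmissible`, the (2.38) pair `AnalyticH ∧ Bound238` of
`toClusterTower 𝔇.Gn k` on the boxes `]0,γ]^{k+1}`, (1.18) `TermBound118`, and `RecAdmissible` on print's TABLE PAIR ([II] p. 15).  THIS FILE serves those five
faces in the primitive currency — each ONE application of the file-23 ∕ 24 face with `hTan :=` file 26 §2 and `hT226 :=` file 26 §2 — so that N18's
configuration-direction chain for W1's generator of record is keyed, with NO analytic and NO (2.26) binder, on: the kernels' holomorphy in `σ` (open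
σ-polydisc) and in `φ` (open table), symmetry ∕ `Re ≻ 0`, (L17a)∕(L16a) at the configuration, LEMMA 2's potential letters along the history under the (1.18)
guard, `χχᶜ` signs ∕ measurability ∕ (2.22), the fibre bound, the (2.24)–(2.26) numerics, and Lemma 3's numerics at `c`.

WHAT (theorems only; the section variables are file 26 §2's, verbatim).  `stepGen_Gn_of_primitives_param` ((GEN): file 23 `stepGen_ofTerms_of_termwise`),
★ `recAdmissible_Gn_of_primitives_param` (W1's `RecAdmissible` — the induction closes), `hLayer_toClusterTower_Gn_of_primitives_param` (the (2.38) pair at every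
step on the boxes read inside `D`), `termBound118_toClusterTower_Gn_of_primitives_param` ((1.18) on every history set read inside `D`),
`recAdmissible_Gn_of_primitives_param₂` (file 24's table pair: older terms on `sp`, the step's (T-an) on `sp′ ⊆ big`, clause `Z ⊆ X ⇒ sp X ⊆ sp′ Z`).

HONEST FRAMING — what this is NOT.  Five one-line compositions of LANDED theorems; NO estimate of Bałaban's is proved here; every kernel, map, region, letter
and number is a HYPOTHESIS; NODE A's kernel records, LEMMA 2, (2.22) and the numerics stay DISPLAYED.  Count-neutral; NOT a discharge of N18 (typed 28∕28 ·
discharged 5∕27 UNCHANGED); NE5 NOT IN PRINT ([I] Thm 1 p. 259) and NOT PROVED.  One finite four-torus programme at fixed `ε`, Bałaban as printed — NOT ℝ⁴,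
NOT infinite volume, NOT OS, NOT a mass gap, NOT Clay.  0 `sorry`, 0 `def`.

References (TYPES ∕ loci only): [II] = [Balaban1988RG2Cluster] CMP **116** (1988) — (1.41) p. 11, (2.14) p. 15 and the analyticity statement p. 15,
(2.16)–(2.26) pp. 16–17, Lemma 3 (2.38) p. 20, (2.41) p. 21, p. 22; [I] = [Balaban1987RG1] CMP **109** (1987) — (1.18) p. 263, Thm 1 p. 259; [Chae1985] Thm 14.13.
-/

noncomputable section

open scoped Classical

namespace Summit.QuantumFields.YangMills.BalabanUVNodes.N18HLayerW1TermAnalyticChain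

open Set Metric
open scoped BigOperators Matrix Matrix.Norms.L2Operator
open Literature.MathematicalPhysics.QuantumFieldTheory.Balaban1983to89
open Literature.MathematicalPhysics.QuantumFieldTheory.Balaban1983to89.T4Continuum (T4Family)
open Literature.MathematicalPhysics.QuantumFieldTheory.Balaban1983to89.TreeLengthTorus (TDom TPt tsys)
open Literature.MathematicalPhysics.QuantumFieldTheory.Balaban1983to89.B13Lemma3TorusTerms (terms weight)
open Literature.MathematicalPhysics.QuantumFieldTheory.Balaban1983to89.B13Bound143 (invTau)
open Literature.MathematicalPhysics.QuantumFieldTheory.Balaban1983to89.B9Thm37GlueTorus (tdist1)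
open Literature.MathematicalPhysics.QuantumFieldTheory.Balaban1983to89.B5TorusCover (UT)
open Literature.MathematicalPhysics.QuantumFieldTheory.Balaban1983to89.Node00
open Literature.MathematicalPhysics.QuantumFieldTheory.Balaban1983to89.Node00.Sect2 (domSys domCount CPair)
open Literature.MathematicalPhysics.QuantumFieldTheory.Balaban1983to89.Node00.W1
open Literature.Analysis.Complex.HolomorphicBanach (analyticOnNhd_of_differentiableOn)
open Summit.QuantumFields.BalabanUV.T4Continuum.Spine.NE5.TwoRunTorusPrimitiveParam (hol_and_h226_torus_of_primitives_param)
open Literature.MathematicalPhysics.QuantumFieldTheory.Balaban1983to89.B12TreeDecay (K₀)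
open Literature.MathematicalPhysics.QuantumFieldTheory.Balaban1983to89.B13Lemma3TorusSocket (Lemma3Numerics)
open Summit.QuantumFields.YangMills.BalabanUVNodes.N18HLayerW1TermIndexed (stepGen_ofTerms_of_termwise recAdmissible_ofTerms_of_termwise
  hLayer_toClusterTower_ofTerms_of_termwise termBound118_toClusterTower_ofTerms_of_termwise)
open Summit.QuantumFields.YangMills.BalabanUVNodes.N18HLayerW1TwoRadiiTerms (recAdmissible_ofTerms_of_termwise₂)
open Summit.QuantumFields.YangMills.BalabanUVNodes.N18HLayerW1TermAnalytic (holAnd226_TF_of_primitives_param termwiseAn_TF_of_primitives_param)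

section Located

variable (F : T4Family) (K : ℕ) {𝔸 : Type} [NormedRing 𝔸] [NormedAlgebra ℂ 𝔸] {M : ℕ} [NeZero M] (L : ℕ) [NeZero L]
  {c : B13.Consts} (𝔇 : TermData214 c (F.P K) 𝔸 M L) (D : Set ℂ)
  (sp big : (j : ℕ) → (domSys (F.P K) M j).Dom → Set (CPair (F.P K) 𝔸)) {E₀ r₁ : ℝ}
  -- the located-inputs tables are OPEN (print's analyticity SPACE (1.15)–(1.17) with the larger radii, [II] p. 15)
  (hbigo : ∀ (k : ℕ) (Z : (domSys (F.P K) M (k + 1)).Dom), IsOpen (big (k + 1) Z))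
  -- the `B13.Consts` letters the (2.26) engine divides by
  (hκ₁ : 1 ≤ c.κ₁) (hα₆ : c.α₆ ≠ 0)
  -- (2.18): the τ-radii `|τ(Y)| = (invTau c (d_k Y))⁻¹ ≥ 2` on every fine torus of the catalogue
  (hpos : ∀ k : ℕ, ∀ Y : TDom (F.P K).d (L * domCount (F.P K) M (k + 1)),
    0 < invTau c ((tsys (F.P K).d (L * domCount (F.P K) M (k + 1))).dj Y))
  (hhalf : ∀ k : ℕ, ∀ Y : TDom (F.P K).d (L * domCount (F.P K) M (k + 1)),
    invTau c ((tsys (F.P K).d (L * domCount (F.P K) M (k + 1))).dj Y) ≤ 1 / 2)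
  -- the Cauchy data: ONE open σ-region ⊇ the closed e^{κ₁}-polydisc, PER-DOMAIN open τ-regions at every level, the contour radii of the data
  {Uσ : Set ℂ} {Uτ : (k : ℕ) → TDom (F.P K).d (L * domCount (F.P K) M (k + 1)) → Set ℂ} (hUσ : IsOpen Uσ) (hUτ : ∀ k Y, IsOpen (Uτ k Y))
  (hUexp : closedBall (0 : ℂ) (Real.exp c.κ₁) ⊆ Uσ)
  (hUtau : ∀ k : ℕ, ∀ Y : TDom (F.P K).d (L * domCount (F.P K) M (k + 1)),
    closedBall (0 : ℂ) ((invTau c ((tsys (F.P K).d (L * domCount (F.P K) M (k + 1))).dj Y))⁻¹) ⊆ Uτ k Y)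
  (hr : ∀ k : ℕ, 0 < (𝔇 k).r) (hr' : ∀ k : ℕ, (𝔇 k).r ≤ Real.exp c.κ₁ - 1)
  (hsubτ : ∀ k : ℕ, ∀ Y, ∀ x ∈ Set.uIcc (0 : ℝ) 1, closedBall (x : ℂ) (𝔇 k).r ⊆ Uτ k Y)
  -- (2.3) at the couplings of `D`: signs and measurability of `χ`, `χᶜ`
  (hχ0 : ∀ (k : ℕ) (Z : (domSys (F.P K) M (k + 1)).Dom) (t : TermLabel (F.P K) M k L), ∀ s ∈ D, ∀ B, 0 ≤ (𝔇 k).chiY₀ Z t s B)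
  (hχc0 : ∀ (k : ℕ) (Z : (domSys (F.P K) M (k + 1)).Dom) (t : TermLabel (F.P K) M k L), ∀ s ∈ D, ∀ B, 0 ≤ (𝔇 k).chicP Z t s B)
  (hχm : ∀ (k : ℕ) (Z : (domSys (F.P K) M (k + 1)).Dom) (t : TermLabel (F.P K) M k L), ∀ s ∈ D, Measurable ((𝔇 k).chiY₀ Z t s))
  (hχcm : ∀ (k : ℕ) (Z : (domSys (F.P K) M (k + 1)).Dom) (t : TermLabel (F.P K) M k L), ∀ s ∈ D, Measurable ((𝔇 k).chicP Z t s))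
  -- NODE A AT THE CONFIGURATION: the kernels `A(σ, uOf φ)`, `G(σ, uOf φ)` entrywise holomorphic IN σ on the open σ-polydisc (each φ of the table) and
  -- IN φ on the open table (each σ of the polydisc) — the records' joint (σ,u)-analyticity ∘ the reading map
  (hAhol : ∀ (k : ℕ) (Z : (domSys (F.P K) M (k + 1)).Dom), ∀ φ ∈ big (k + 1) Z, ∀ t ∈ terms L M Z,
    ∀ i j, DifferentiableOn ℂ (fun σ => (𝔇 k).A Z t φ σ i j) {σ | ∀ j, σ j ∈ Uσ})
  (hGhol : ∀ (k : ℕ) (Z : (domSys (F.P K) M (k + 1)).Dom), ∀ φ ∈ big (k + 1) Z, ∀ t ∈ terms L M Z,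
    ∀ i j, DifferentiableOn ℂ (fun σ => ((𝔇 k).𝒦 Z t).G2 σ ((𝔇 k).uOf Z t φ) i j) {σ | ∀ j, σ j ∈ Uσ})
  (hAholφ : ∀ (k : ℕ) (Z : (domSys (F.P K) M (k + 1)).Dom), ∀ t ∈ terms L M Z, ∀ σ : TPt (F.P K).d (domCount (F.P K) M (k + 1)) → ℂ,
    (∀ j, σ j ∈ Uσ) → ∀ i j, DifferentiableOn ℂ (fun φ => (𝔇 k).A Z t φ σ i j) (big (k + 1) Z))
  (hGholφ : ∀ (k : ℕ) (Z : (domSys (F.P K) M (k + 1)).Dom), ∀ t ∈ terms L M Z, ∀ σ : TPt (F.P K).d (domCount (F.P K) M (k + 1)) → ℂ,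
    (∀ j, σ j ∈ Uσ) → ∀ i j, DifferentiableOn ℂ (fun φ => ((𝔇 k).𝒦 Z t).G2 σ ((𝔇 k).uOf Z t φ) i j) (big (k + 1) Z))
  -- LEMMA 2 ALONG THE HISTORY ([II] (1.41), p. 15): under «old ∈ (1.18)`(E₀,r₁)` on the tables + analytic there» the potentials `𝐕_k(Y, g, old, φ, ·)` are
  -- holomorphic IN φ on the open table and measurable in the row-bond field, with the (2.20) shape on the open PER-DOMAIN τ-region
  (hVholφ : ∀ k : ℕ, ∀ s ∈ D, ∀ old : OlderTerms (F.P K) 𝔸 M k,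
    (∀ (j : Fin (k + 1)) (Y : (domSys (F.P K) M j).Dom), ∀ ψ ∈ sp j Y,
        ‖old j Y ψ‖ ≤ E₀ * Real.exp (-(r₁ * (domSys (F.P K) M j).dj Y))) →
    (∀ (j : Fin (k + 1)) (Y : (domSys (F.P K) M j).Dom), AnalyticOnNhd ℂ (old j Y) (sp j Y)) →
    ∀ (Z : (domSys (F.P K) M (k + 1)).Dom), ∀ t ∈ terms L M Z,
      ∀ Y B, DifferentiableOn ℂ (fun φ => (𝔇 k).𝒱 Z t s old φ Y B) (big (k + 1) Z))
  (hVm : ∀ k : ℕ, ∀ s ∈ D, ∀ old : OlderTerms (F.P K) 𝔸 M k,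
    (∀ (j : Fin (k + 1)) (Y : (domSys (F.P K) M j).Dom), ∀ ψ ∈ sp j Y,
        ‖old j Y ψ‖ ≤ E₀ * Real.exp (-(r₁ * (domSys (F.P K) M j).dj Y))) →
    (∀ (j : Fin (k + 1)) (Y : (domSys (F.P K) M j).Dom), AnalyticOnNhd ℂ (old j Y) (sp j Y)) →
    ∀ (Z : (domSys (F.P K) M (k + 1)).Dom), ∀ φ ∈ big (k + 1) Z, ∀ t ∈ terms L M Z, ∀ Y, Measurable ((𝔇 k).𝒱 Z t s old φ Y))
  -- NODE A ([II] p. 15): symmetry and `Re ≻ 0` of the precision `A(σ, u(φ))` on the open σ-polydisc, at the configurations of the table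
  (hAs : ∀ (k : ℕ) (Z : (domSys (F.P K) M (k + 1)).Dom), ∀ φ ∈ big (k + 1) Z, ∀ t ∈ terms L M Z,
    ∀ σ : TPt (F.P K).d (domCount (F.P K) M (k + 1)) → ℂ, (∀ j, σ j ∈ Uσ) → ((𝔇 k).A Z t φ σ).IsSymm)
  (hA : ∀ (k : ℕ) (Z : (domSys (F.P K) M (k + 1)).Dom), ∀ φ ∈ big (k + 1) Z, ∀ t ∈ terms L M Z,
    ∀ σ : TPt (F.P K).d (domCount (F.P K) M (k + 1)) → ℂ, (∀ j, σ j ∈ Uσ) → (((𝔇 k).A Z t φ σ).map Complex.re).PosDef)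
  -- [II] (2.22) for `χχᶜ` at the couplings of `D` (quadratic forms `qP ≤ B·B`) and LEMMA 2's (2.20) on the open per-domain τ-region ALONG THE HISTORY
  {γ₂ rP a₂₀ w : ℝ} (hγ₂ : 0 ≤ γ₂) (ha0 : 0 ≤ a₂₀)
  (qP : (k : ℕ) → (Z : (domSys (F.P K) M (k + 1)).Dom) → (t : TermLabel (F.P K) M k L) → (((𝔇 k).𝒦 Z t).Λ → ℝ) → ℝ)
  (hqP : ∀ (k : ℕ) (Z : (domSys (F.P K) M (k + 1)).Dom) (t : TermLabel (F.P K) M k L) (B : ((𝔇 k).𝒦 Z t).Λ → ℝ), qP k Z t B ≤ B ⬝ᵥ B)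
  (h222 : ∀ (k : ℕ) (Z : (domSys (F.P K) M (k + 1)).Dom) (t : TermLabel (F.P K) M k L), ∀ s ∈ D, ∀ B : ((𝔇 k).𝒦 Z t).Λ → ℝ,
    (𝔇 k).chiY₀ Z t s B * (𝔇 k).chicP Z t s B ≤ Real.exp (-(γ₂ / 2 * rP ^ 2 * (t.2.card : ℕ)) + γ₂ / 2 * qP k Z t B))
  (h220U : ∀ k : ℕ, ∀ s ∈ D, ∀ old : OlderTerms (F.P K) 𝔸 M k,
    (∀ (j : Fin (k + 1)) (Y : (domSys (F.P K) M j).Dom), ∀ ψ ∈ sp j Y,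
        ‖old j Y ψ‖ ≤ E₀ * Real.exp (-(r₁ * (domSys (F.P K) M j).dj Y))) →
    (∀ (j : Fin (k + 1)) (Y : (domSys (F.P K) M j).Dom), AnalyticOnNhd ℂ (old j Y) (sp j Y)) →
    ∀ (Z : (domSys (F.P K) M (k + 1)).Dom), ∀ φ ∈ big (k + 1) Z, ∀ t ∈ terms L M Z,
      ∀ τ : TDom (F.P K).d (L * domCount (F.P K) M (k + 1)) → ℂ, (∀ Y, τ Y ∈ Uτ k Y) →
        ∀ B : ((𝔇 k).𝒦 Z t).Λ → ℝ, ∑ Y ∈ t.1, ‖τ Y‖ * ‖(𝔇 k).𝒱 Z t s old φ Y B‖ ≤ a₂₀ / 2 * (B ⬝ᵥ B) + w)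
  -- the column fibre bound of the kernel record's locations
  (hfibN : ∀ (k : ℕ) (Z : (domSys (F.P K) M (k + 1)).Dom) (t : TermLabel (F.P K) M k L) (x : UT (𝔇 k).Nf),
    (Finset.univ.filter fun j => ((𝔇 k).𝒦 Z t).locN j = x).card ≤ ((𝔇 k).𝒦 Z t).m)
  -- rates and uniform constants
  {kap kap' kap'' θ θE θΓ θC KG KΓ KCs KC : ℝ} (hkap'' : 0 < kap'') (h1 : kap'' < kap') (h2 : kap' < kap)
  (hθE : 0 ≤ θE) (hθΓ : 0 ≤ θΓ) (hθC : 0 ≤ θC) (hKG : 0 ≤ KG) (hKΓ : 0 ≤ KΓ) (hKCs : 0 ≤ KCs) (hKC : 0 ≤ KC)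
  (hθEle : θE ≤ θ) (hθΓle : θΓ ≤ θ)
  (hθR1le : ∀ (k : ℕ) (Z : (domSys (F.P K) M (k + 1)).Dom) (t : TermLabel (F.P K) M k L),
    ((((𝔇 k).𝒦 Z t).m : ℝ) * (1 + 2 / (kap - kap')) ^ (𝔇 k).ν) * ((((𝔇 k).𝒦 Z t).m : ℝ) * (1 + 2 / (kap' - kap'')) ^ (𝔇 k).ν)
      * (θΓ * KCs * KG + KΓ * θC * KG + KΓ * KC * θΓ) ≤ θ)
  -- NODE A AT THE CONFIGURATION: (L17a) and (L16a) for the kernel record read at `u = uOf Z t φ`, on the open σ-polydisc, uniform on the table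
  (hG : ∀ (k : ℕ) (Z : (domSys (F.P K) M (k + 1)).Dom), ∀ φ ∈ big (k + 1) Z, ∀ t ∈ terms L M Z,
    ∀ σ : TPt (F.P K).d (domCount (F.P K) M (k + 1)) → ℂ, (∀ j, σ j ∈ Uσ) → ∀ b j, ‖((𝔇 k).𝒦 Z t).G2 σ ((𝔇 k).uOf Z t φ) b j‖ ≤
      KG * Real.exp (-(kap * tdist1 (𝔇 k).Nf (((𝔇 k).𝒦 Z t).locΛ b) (((𝔇 k).𝒦 Z t).locN j))))
  (hΓ₀ : ∀ (k : ℕ) (Z : (domSys (F.P K) M (k + 1)).Dom) (t : TermLabel (F.P K) M k L), ∀ b j, ‖((𝔇 k).𝒦 Z t).Γ₀ b j‖ ≤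
      KΓ * Real.exp (-(kap * tdist1 (𝔇 k).Nf (((𝔇 k).𝒦 Z t).locΛ b) (((𝔇 k).𝒦 Z t).locN j))))
  (hCs : ∀ (k : ℕ) (Z : (domSys (F.P K) M (k + 1)).Dom), ∀ φ ∈ big (k + 1) Z, ∀ t ∈ terms L M Z,
    ∀ σ : TPt (F.P K).d (domCount (F.P K) M (k + 1)) → ℂ, (∀ j, σ j ∈ Uσ) → ∀ b b', ‖((𝔇 k).A Z t φ σ)⁻¹ b b'‖ ≤
      KCs * Real.exp (-(kap * tdist1 (𝔇 k).Nf (((𝔇 k).𝒦 Z t).locΛ b) (((𝔇 k).𝒦 Z t).locΛ b'))))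
  (hC216 : ∀ (k : ℕ) (Z : (domSys (F.P K) M (k + 1)).Dom) (t : TermLabel (F.P K) M k L), ∀ b b', ‖((𝔇 k).𝒦 Z t).C b b'‖ ≤
      KC * Real.exp (-(kap * tdist1 (𝔇 k).Nf (((𝔇 k).𝒦 Z t).locΛ b) (((𝔇 k).𝒦 Z t).locΛ b'))))
  (hdΓ : ∀ (k : ℕ) (Z : (domSys (F.P K) M (k + 1)).Dom), ∀ φ ∈ big (k + 1) Z, ∀ t ∈ terms L M Z,
    ∀ σ : TPt (F.P K).d (domCount (F.P K) M (k + 1)) → ℂ, (∀ j, σ j ∈ Uσ) →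
      ∀ b j, ‖(((𝔇 k).𝒦 Z t).G2 σ ((𝔇 k).uOf Z t φ) - ((𝔇 k).𝒦 Z t).Γ₀.map (algebraMap ℝ ℂ)) b j‖ ≤
        θΓ * Real.exp (-(kap * tdist1 (𝔇 k).Nf (((𝔇 k).𝒦 Z t).locΛ b) (((𝔇 k).𝒦 Z t).locN j))))
  (hdC : ∀ (k : ℕ) (Z : (domSys (F.P K) M (k + 1)).Dom), ∀ φ ∈ big (k + 1) Z, ∀ t ∈ terms L M Z,
    ∀ σ : TPt (F.P K).d (domCount (F.P K) M (k + 1)) → ℂ, (∀ j, σ j ∈ Uσ) →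
      ∀ b b', ‖(((𝔇 k).A Z t φ σ)⁻¹ - ((𝔇 k).𝒦 Z t).C.map (algebraMap ℝ ℂ)) b b'‖ ≤
        θC * Real.exp (-(kap * tdist1 (𝔇 k).Nf (((𝔇 k).𝒦 Z t).locΛ b) (((𝔇 k).𝒦 Z t).locΛ b'))))
  (hdE : ∀ (k : ℕ) (Z : (domSys (F.P K) M (k + 1)).Dom), ∀ φ ∈ big (k + 1) Z, ∀ t ∈ terms L M Z,
    ∀ σ : TPt (F.P K).d (domCount (F.P K) M (k + 1)) → ℂ, (∀ j, σ j ∈ Uσ) →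
      ∀ b b', ‖((𝔇 k).A Z t φ σ - ((𝔇 k).𝒦 Z t).C⁻¹.map (algebraMap ℝ ℂ)) b b'‖ ≤
        θE * Real.exp (-(kap * tdist1 (𝔇 k).Nf (((𝔇 k).𝒦 Z t).locΛ b) (((𝔇 k).𝒦 Z t).locΛ b'))))
  (hsmallKθ : ∀ (k : ℕ) (Z : (domSys (F.P K) M (k + 1)).Dom) (t : TermLabel (F.P K) M k L),
    KC * ((((𝔇 k).𝒦 Z t).m : ℝ) * (1 + 2 / kap) ^ (𝔇 k).ν) * (θ * ((((𝔇 k).𝒦 Z t).m : ℝ) * (1 + 2 / kap'') ^ (𝔇 k).ν)) < 1)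
  -- the (2.24)–(2.25) smallness per term, uniform constants
  {cE gq : ℝ} (hc0 : 0 ≤ cE)
  (hc : ∀ (k : ℕ) (Z : (domSys (F.P K) M (k + 1)).Dom) (t : TermLabel (F.P K) M k L) (i : ((𝔇 k).𝒦 Z t).Λ),
    ((𝔇 k).𝒦 Z t).hC.1.eigenvalues i ≤ cE)
  (hαc : ∀ (k : ℕ) (Z : (domSys (F.P K) M (k + 1)).Dom) (t : TermLabel (F.P K) M k L),
    (2 * (θ * ((((𝔇 k).𝒦 Z t).m : ℝ) * (1 + 2 / kap'') ^ (𝔇 k).ν)) + (γ₂ + a₂₀)) * cE ≤ 1 / 2)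
  (hg : 0 ≤ gq)
  (hΓq : ∀ (k : ℕ) (Z : (domSys (F.P K) M (k + 1)).Dom) (t : TermLabel (F.P K) M k L) (X : ((𝔇 k).𝒦 Z t).Λ ⊕ ((𝔇 k).𝒦 Z t).C₀ → ℝ),
    (((𝔇 k).𝒦 Z t).Γ₀ *ᵥ X) ⬝ᵥ (((𝔇 k).𝒦 Z t).C *ᵥ (((𝔇 k).𝒦 Z t).Γ₀ *ᵥ X)) ≤ gq * (X ⬝ᵥ X))
  (hsm25 : ∀ (k : ℕ) (Z : (domSys (F.P K) M (k + 1)).Dom) (t : TermLabel (F.P K) M k L),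
    (2 * (θ * ((((𝔇 k).𝒦 Z t).m : ℝ) * (1 + 2 / kap'') ^ (𝔇 k).ν)) + (γ₂ + a₂₀)) * (1 + 2 * cE * gq) ≤ 1 / 2)
  -- constant matching, [II] p. 17: the |P|-rate of the weights and «exp O(1)α₅|Z|»
  {a a₅ : ℝ} (hPa : a ≤ γ₂ * rP ^ 2)
  (hvol : ∀ (k : ℕ) (Z : (domSys (F.P K) M (k + 1)).Dom) (t : TermLabel (F.P K) M k L),
    2 * (KC * ((((𝔇 k).𝒦 Z t).m : ℝ) * (1 + 2 / kap) ^ (𝔇 k).ν) * (θ * ((((𝔇 k).𝒦 Z t).m : ℝ) * (1 + 2 / kap'') ^ (𝔇 k).ν))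
            * (1 + (1 - KC * ((((𝔇 k).𝒦 Z t).m : ℝ) * (1 + 2 / kap) ^ (𝔇 k).ν)
              * (θ * ((((𝔇 k).𝒦 Z t).m : ℝ) * (1 + 2 / kap'') ^ (𝔇 k).ν)))⁻¹) / 2)
        * (Fintype.card ((𝔇 k).𝒦 Z t).Λ : ℝ)
      + w + (2 * (θ * ((((𝔇 k).𝒦 Z t).m : ℝ) * (1 + 2 / kap'') ^ (𝔇 k).ν)) + (γ₂ + a₂₀)) * cE * (Fintype.card ((𝔇 k).𝒦 Z t).Λ : ℝ)
      + (2 * (θ * ((((𝔇 k).𝒦 Z t).m : ℝ) * (1 + 2 / kap'') ^ (𝔇 k).ν)) + (γ₂ + a₂₀)) * (1 + 2 * cE * gq)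
        * (Fintype.card (((𝔇 k).𝒦 Z t).Λ ⊕ ((𝔇 k).𝒦 Z t).C₀) : ℝ)
      ≤ a₅ * ((Z.1).card : ℝ))

include hbigo hκ₁ hα₆ hpos hhalf hUσ hUτ hUexp hUtau hr hr' hsubτ hχ0 hχc0 hχm hχcm hAhol hGhol hAholφ hGholφ hVholφ hVm hAs hA hγ₂ ha0 hqP h222 h220U
  hfibN hkap'' h1 h2 hθE hθΓ hθC hKG hKΓ hKCs hKC hθEle hθΓle hθR1le hG hΓ₀ hCs hC216 hdΓ hdC hdE hsmallKθ hc0 hc hαc hg hΓq hsm25 hPa hvol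

/-- **(GEN) FOR THE DATUM's GENERATOR `𝔇.Gn` FROM THE LOCATED PRIMITIVE INPUTS** (file 23 `stepGen_ofTerms_of_termwise`, `hTan` ∕ `hT226 :=` file 26 §2 on
`sp (k+1) Z ⊆ big (k+1) Z`): for every step, every `g ∈ D` and every older-term table in the guard class the activities `(𝔇.Gn k).H g old · Z` are analytic at the
points of `sp (k+1) Z` and (2.38)-bounded there with `A = C₃ε₁`, `R = (1−8δ)·½L·κ`. [cite: Balaban1988RG2Cluster, (2.14) p.15 and the analyticity statement p.15, (2.26) p.17 and Lemma 3 (2.38) p.20] -/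
theorem stepGen_Gn_of_primitives_param (hL8 : 8 ≤ c.L) (hLc : c.L = L)
    {a₂ a₂' Aabs : ℝ} (hN : Lemma3Numerics c M ((c.L : ℝ) / 2) a a₂ a₂' a₅ Aabs)
    (hbig : ∀ (k : ℕ) (Z : (domSys (F.P K) M (k + 1)).Dom), sp (k + 1) Z ⊆ big (k + 1) Z) :
    ∀ k : ℕ, ∀ s ∈ D, ∀ old : OlderTerms (F.P K) 𝔸 M k,
      (∀ (j : Fin (k + 1)) (Y : (domSys (F.P K) M j).Dom), ∀ ψ ∈ sp j Y,
          ‖old j Y ψ‖ ≤ E₀ * Real.exp (-(r₁ * (domSys (F.P K) M j).dj Y))) →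
      (∀ (j : Fin (k + 1)) (Y : (domSys (F.P K) M j).Dom), AnalyticOnNhd ℂ (old j Y) (sp j Y)) →
      (∀ Z : (domSys (F.P K) M (k + 1)).Dom, AnalyticOnNhd ℂ (fun φ => (𝔇.Gn k).H s old φ Z) (sp (k + 1) Z)) ∧
      (∀ (Z : (domSys (F.P K) M (k + 1)).Dom), ∀ φ ∈ sp (k + 1) Z,
          ‖(𝔇.Gn k).H s old φ Z‖ ≤
            c.C3act * c.ε₁ * Real.exp (-((1 - 8 * c.δ) * ((c.L : ℝ) / 2) * c.κ * (domSys (F.P K) M (k + 1)).dj Z))) :=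
  stepGen_ofTerms_of_termwise F K L 𝔇.TF D sp c hL8 hLc hN
    (termwiseAn_TF_of_primitives_param F K L 𝔇 D sp big hbigo hκ₁ hα₆ hpos hhalf hUσ hUτ hUexp hUtau hr hr' hsubτ hχ0 hχc0 hχm hχcm hAhol
      hGhol hAholφ hGholφ hVholφ hVm hAs hA hγ₂ ha0 qP hqP h222 h220U hfibN hkap'' h1 h2 hθE hθΓ hθC hKG hKΓ hKCs hKC hθEle hθΓle hθR1le hG hΓ₀ hCs
      hC216 hdΓ hdC hdE hsmallKθ hc0 hc hαc hg hΓq hsm25 hPa hvol sp hbig)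
    (fun k s hs old hB hAn Z φ hφ t ht =>
      (holAnd226_TF_of_primitives_param F K L 𝔇 D sp big hbigo hκ₁ hα₆ hpos hhalf hUσ hUτ hUexp hUtau hr hr' hsubτ hχ0 hχc0 hχm hχcm hAhol
      hGhol hAholφ hGholφ hVholφ hVm hAs hA hγ₂ ha0 qP hqP h222 h220U hfibN hkap'' h1 h2 hθE hθΓ hθC hKG hKΓ hKCs hKC hθEle hθΓle hθR1le hG hΓ₀ hCs
      hC216 hdΓ hdC hdE hsmallKθ hc0 hc hαc hg hΓq hsm25 hPa hvol k s hs old hB hAn Z t ht).2 φ (hbig k Z hφ))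

/-- **★ W1's `RecAdmissible` FOR THE DATUM's GENERATOR FROM THE LOCATED PRIMITIVE INPUTS** (file 23 `recAdmissible_ofTerms_of_termwise`, BOTH schema binders
discharged by file 26 §2): along every history with values in `D` the generated older terms lie in the class «(1.18)`(E₀,r₁)` on the tables + analytic there» —
the guard of LEMMA 2's inputs: THE INDUCTION CLOSES. [cite: Balaban1987RG1, (1.18) p.263 and Thm 1 p.259; Balaban1988RG2Cluster, (1.41) p.11, (2.14) p.15, (2.26) p.17, p.22] -/
theorem recAdmissible_Gn_of_primitives_param (hrestr : ∀ k, W1.SpRestr (sp (k + 1))) (hL8 : 8 ≤ c.L) (hLc : c.L = L)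
    {a₂ a₂' Aabs : ℝ} (hN : Lemma3Numerics c M ((c.L : ℝ) / 2) a a₂ a₂' a₅ Aabs)
    (hbig : ∀ (k : ℕ) (Z : (domSys (F.P K) M (k + 1)).Dom), sp (k + 1) Z ⊆ big (k + 1) Z)
    (hr₁ : 0 ≤ r₁) (hApos : 0 ≤ c.C3act * c.ε₁) (hrate : r₁ + 2 * (64 * Real.log 162) + 2 ≤ (1 - 8 * c.δ) * ((c.L : ℝ) / 2) * c.κ)
    (hKP : c.C3act * c.ε₁ * Real.exp (5 * r₁ + 1) * K₀ 64 8 * 9 * 64 < 1)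
    (hrenew : Real.exp 1 * 9 * 64 * K₀ 64 8 ^ 2 * (c.C3act * c.ε₁) ≤ E₀) :
    RecAdmissible 𝔇.Gn D fun k => {old : OlderTerms (F.P K) 𝔸 M k |
      (∀ (j : Fin (k + 1)) (Y : (domSys (F.P K) M j).Dom), ∀ ψ ∈ sp j Y,
          ‖old j Y ψ‖ ≤ E₀ * Real.exp (-(r₁ * (domSys (F.P K) M j).dj Y))) ∧
      (∀ (j : Fin (k + 1)) (Y : (domSys (F.P K) M j).Dom), AnalyticOnNhd ℂ (old j Y) (sp j Y))} :=
  recAdmissible_ofTerms_of_termwise F K L 𝔇.TF D sp hrestr c hL8 hLc hN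
    (termwiseAn_TF_of_primitives_param F K L 𝔇 D sp big hbigo hκ₁ hα₆ hpos hhalf hUσ hUτ hUexp hUtau hr hr' hsubτ hχ0 hχc0 hχm hχcm hAhol
      hGhol hAholφ hGholφ hVholφ hVm hAs hA hγ₂ ha0 qP hqP h222 h220U hfibN hkap'' h1 h2 hθE hθΓ hθC hKG hKΓ hKCs hKC hθEle hθΓle hθR1le hG hΓ₀ hCs
      hC216 hdΓ hdC hdE hsmallKθ hc0 hc hαc hg hΓq hsm25 hPa hvol sp hbig)
    (fun k s hs old hB hAn Z φ hφ t ht =>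
      (holAnd226_TF_of_primitives_param F K L 𝔇 D sp big hbigo hκ₁ hα₆ hpos hhalf hUσ hUτ hUexp hUtau hr hr' hsubτ hχ0 hχc0 hχm hχcm hAhol
      hGhol hAholφ hGholφ hVholφ hVm hAs hA hγ₂ ha0 qP hqP h222 h220U hfibN hkap'' h1 h2 hθE hθΓ hθC hKG hKΓ hKCs hKC hθEle hθΓle hθR1le hG hΓ₀ hCs
      hC216 hdΓ hdC hdE hsmallKθ hc0 hc hαc hg hΓq hsm25 hPa hvol k s hs old hB hAn Z t ht).2 φ (hbig k Z hφ))
    hr₁ hApos hrate hKP hrenew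

/-- **THE (2.38) PAIR AT EVERY STEP OF `toClusterTower 𝔇.Gn` ON THE BOXES `]0, γ]^{k+1}` read inside `D`, FROM THE LOCATED PRIMITIVE INPUTS** (file 23
`hLayer_toClusterTower_ofTerms_of_termwise`) — the per-step H-layer hypotheses of files 9–13 and of dag-n18-d's junctions, at the datum.
[cite: Balaban1988RG2Cluster, (2.14) p.15, (2.26) p.17, Lemma 3 (2.38) p.20; Balaban1987RG1, Thm 1 p.259] -/
theorem hLayer_toClusterTower_Gn_of_primitives_param {γ : ℝ} (hrestr : ∀ k, W1.SpRestr (sp (k + 1))) (hL8 : 8 ≤ c.L) (hLc : c.L = L)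
    {a₂ a₂' Aabs : ℝ} (hN : Lemma3Numerics c M ((c.L : ℝ) / 2) a a₂ a₂' a₅ Aabs)
    (hbig : ∀ (k : ℕ) (Z : (domSys (F.P K) M (k + 1)).Dom), sp (k + 1) Z ⊆ big (k + 1) Z)
    (hr₁ : 0 ≤ r₁) (hApos : 0 ≤ c.C3act * c.ε₁) (hrate : r₁ + 2 * (64 * Real.log 162) + 2 ≤ (1 - 8 * c.δ) * ((c.L : ℝ) / 2) * c.κ)
    (hKP : c.C3act * c.ε₁ * Real.exp (5 * r₁ + 1) * K₀ 64 8 * 9 * 64 < 1)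
    (hrenew : Real.exp 1 * 9 * 64 * K₀ 64 8 ^ 2 * (c.C3act * c.ε₁) ≤ E₀) (hD : ∀ s ∈ Ioc (0 : ℝ) γ, ((s : ℝ) : ℂ) ∈ D) :
    ∀ k, (toClusterTower 𝔇.Gn k).AnalyticH (box γ k) (sp (k + 1)) ∧
      (toClusterTower 𝔇.Gn k).Bound238 (box γ k) (sp (k + 1)) (c.C3act * c.ε₁) ((1 - 8 * c.δ) * ((c.L : ℝ) / 2) * c.κ) :=
  hLayer_toClusterTower_ofTerms_of_termwise F K L 𝔇.TF D sp hrestr c hL8 hLc hN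
    (termwiseAn_TF_of_primitives_param F K L 𝔇 D sp big hbigo hκ₁ hα₆ hpos hhalf hUσ hUτ hUexp hUtau hr hr' hsubτ hχ0 hχc0 hχm hχcm hAhol
      hGhol hAholφ hGholφ hVholφ hVm hAs hA hγ₂ ha0 qP hqP h222 h220U hfibN hkap'' h1 h2 hθE hθΓ hθC hKG hKΓ hKCs hKC hθEle hθΓle hθR1le hG hΓ₀ hCs
      hC216 hdΓ hdC hdE hsmallKθ hc0 hc hαc hg hΓq hsm25 hPa hvol sp hbig)
    (fun k s hs old hB hAn Z φ hφ t ht =>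
      (holAnd226_TF_of_primitives_param F K L 𝔇 D sp big hbigo hκ₁ hα₆ hpos hhalf hUσ hUτ hUexp hUtau hr hr' hsubτ hχ0 hχc0 hχm hχcm hAhol
      hGhol hAholφ hGholφ hVholφ hVm hAs hA hγ₂ ha0 qP hqP h222 h220U hfibN hkap'' h1 h2 hθE hθΓ hθC hKG hKΓ hKCs hKC hθEle hθΓle hθR1le hG hΓ₀ hCs
      hC216 hdΓ hdC hdE hsmallKθ hc0 hc hαc hg hΓq hsm25 hPa hvol k s hs old hB hAn Z t ht).2 φ (hbig k Z hφ))
    hr₁ hApos hrate hKP hrenew hD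

/-- **(1.18) FOR THE GENERATED TOWER OF THE DATUM on every history set read inside `D`, FROM THE LOCATED PRIMITIVE INPUTS** (file 23
`termBound118_toClusterTower_ofTerms_of_termwise`). [cite: Balaban1987RG1, (1.18) p.263 and Thm 1 p.259; Balaban1988RG2Cluster, (2.26) p.17, (2.41) p.21 and p.22] -/
theorem termBound118_toClusterTower_Gn_of_primitives_param (hrestr : ∀ k, W1.SpRestr (sp (k + 1))) (hL8 : 8 ≤ c.L) (hLc : c.L = L)
    {a₂ a₂' Aabs : ℝ} (hN : Lemma3Numerics c M ((c.L : ℝ) / 2) a a₂ a₂' a₅ Aabs)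
    (hbig : ∀ (k : ℕ) (Z : (domSys (F.P K) M (k + 1)).Dom), sp (k + 1) Z ⊆ big (k + 1) Z)
    (hr₁ : 0 ≤ r₁) (hApos : 0 ≤ c.C3act * c.ε₁) (hrate : r₁ + 2 * (64 * Real.log 162) + 2 ≤ (1 - 8 * c.δ) * ((c.L : ℝ) / 2) * c.κ)
    (hKP : c.C3act * c.ε₁ * Real.exp (5 * r₁ + 1) * K₀ 64 8 * 9 * 64 < 1)
    (hrenew : Real.exp 1 * 9 * 64 * K₀ 64 8 ^ 2 * (c.C3act * c.ε₁) ≤ E₀) (W : Set (ℕ → ℝ)) (hW : ∀ g ∈ W, ∀ n, ((g n : ℝ) : ℂ) ∈ D) :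
    TermBound118 (toClusterTower 𝔇.Gn) W sp E₀ r₁ :=
  termBound118_toClusterTower_ofTerms_of_termwise F K L 𝔇.TF D sp hrestr c hL8 hLc hN
    (termwiseAn_TF_of_primitives_param F K L 𝔇 D sp big hbigo hκ₁ hα₆ hpos hhalf hUσ hUτ hUexp hUtau hr hr' hsubτ hχ0 hχc0 hχm hχcm hAhol
      hGhol hAholφ hGholφ hVholφ hVm hAs hA hγ₂ ha0 qP hqP h222 h220U hfibN hkap'' h1 h2 hθE hθΓ hθC hKG hKΓ hKCs hKC hθEle hθΓle hθR1le hG hΓ₀ hCs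
      hC216 hdΓ hdC hdE hsmallKθ hc0 hc hαc hg hΓq hsm25 hPa hvol sp hbig)
    (fun k s hs old hB hAn Z φ hφ t ht =>
      (holAnd226_TF_of_primitives_param F K L 𝔇 D sp big hbigo hκ₁ hα₆ hpos hhalf hUσ hUτ hUexp hUtau hr hr' hsubτ hχ0 hχc0 hχm hχcm hAhol
      hGhol hAholφ hGholφ hVholφ hVm hAs hA hγ₂ ha0 qP hqP h222 h220U hfibN hkap'' h1 h2 hθE hθΓ hθC hKG hKΓ hKCs hKC hθEle hθΓle hθR1le hG hΓ₀ hCs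
      hC216 hdΓ hdC hdE hsmallKθ hc0 hc hαc hg hΓq hsm25 hPa hvol k s hs old hB hAn Z t ht).2 φ (hbig k Z hφ))
    hr₁ hApos hrate hKP hrenew W hW

/-- **W1's `RecAdmissible` ON `sp` FOR THE DATUM's GENERATOR ON PRINT's TABLE PAIR, FROM THE LOCATED PRIMITIVE INPUTS** (file 24
`recAdmissible_ofTerms_of_termwise₂`): older terms read on `sp`, the step's (T-an) on the LARGER table `sp′` inside the located-inputs table, the clause
`Z ⊆ X ⇒ sp X ⊆ sp′ Z` ([II] p. 15: restrict through the (i)–(iii)-space with the larger radii).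
[cite: Balaban1988RG2Cluster, p.15, (2.14) p.15, (2.26) p.17; Balaban1987RG1, (1.18) p.263 and Thm 1 p.259] -/
theorem recAdmissible_Gn_of_primitives_param₂ (sp' : (j : ℕ) → (domSys (F.P K) M j).Dom → Set (CPair (F.P K) 𝔸))
    (hrestr : ∀ k, ∀ X Z : (domSys (F.P K) M (k + 1)).Dom, Z.1 ⊆ X.1 → sp (k + 1) X ⊆ sp' (k + 1) Z) (hL8 : 8 ≤ c.L) (hLc : c.L = L)
    {a₂ a₂' Aabs : ℝ} (hN : Lemma3Numerics c M ((c.L : ℝ) / 2) a a₂ a₂' a₅ Aabs)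
    (hbig : ∀ (k : ℕ) (Z : (domSys (F.P K) M (k + 1)).Dom), sp' (k + 1) Z ⊆ big (k + 1) Z)
    (hr₁ : 0 ≤ r₁) (hApos : 0 ≤ c.C3act * c.ε₁) (hrate : r₁ + 2 * (64 * Real.log 162) + 2 ≤ (1 - 8 * c.δ) * ((c.L : ℝ) / 2) * c.κ)
    (hKP : c.C3act * c.ε₁ * Real.exp (5 * r₁ + 1) * K₀ 64 8 * 9 * 64 < 1)
    (hrenew : Real.exp 1 * 9 * 64 * K₀ 64 8 ^ 2 * (c.C3act * c.ε₁) ≤ E₀) :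
    RecAdmissible 𝔇.Gn D fun k => {old : OlderTerms (F.P K) 𝔸 M k |
      (∀ (j : Fin (k + 1)) (Y : (domSys (F.P K) M j).Dom), ∀ ψ ∈ sp j Y,
          ‖old j Y ψ‖ ≤ E₀ * Real.exp (-(r₁ * (domSys (F.P K) M j).dj Y))) ∧
      (∀ (j : Fin (k + 1)) (Y : (domSys (F.P K) M j).Dom), AnalyticOnNhd ℂ (old j Y) (sp j Y))} :=
  recAdmissible_ofTerms_of_termwise₂ F K L 𝔇.TF D sp sp' hrestr c hL8 hLc hN
    (termwiseAn_TF_of_primitives_param F K L 𝔇 D sp big hbigo hκ₁ hα₆ hpos hhalf hUσ hUτ hUexp hUtau hr hr' hsubτ hχ0 hχc0 hχm hχcm hAhol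
      hGhol hAholφ hGholφ hVholφ hVm hAs hA hγ₂ ha0 qP hqP h222 h220U hfibN hkap'' h1 h2 hθE hθΓ hθC hKG hKΓ hKCs hKC hθEle hθΓle hθR1le hG hΓ₀ hCs
      hC216 hdΓ hdC hdE hsmallKθ hc0 hc hαc hg hΓq hsm25 hPa hvol sp' hbig)
    (fun k s hs old hB hAn Z φ hφ t ht =>
      (holAnd226_TF_of_primitives_param F K L 𝔇 D sp big hbigo hκ₁ hα₆ hpos hhalf hUσ hUτ hUexp hUtau hr hr' hsubτ hχ0 hχc0 hχm hχcm hAhol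
      hGhol hAholφ hGholφ hVholφ hVm hAs hA hγ₂ ha0 qP hqP h222 h220U hfibN hkap'' h1 h2 hθE hθΓ hθC hKG hKΓ hKCs hKC hθEle hθΓle hθR1le hG hΓ₀ hCs
      hC216 hdΓ hdC hdE hsmallKθ hc0 hc hαc hg hΓq hsm25 hPa hvol k s hs old hB hAn Z t ht).2 φ (hbig k Z hφ))
    hr₁ hApos hrate hKP hrenew

end Located

end Summit.QuantumFields.YangMills.BalabanUVNodes.N18HLayerW1TermAnalyticChain

end
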